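import Literature.NumberTheory.GaloisCohomology.Howard2004.ConjugationDatumInertiaProofs
import Literature.NumberTheory.GaloisCohomology.Howard2004.ChebotarevInertPrimesProofs
import Mathlib.RingTheory.RootsOfUnity.AlgebraicallyClosed
import Mathlib.NumberTheory.Padics.RingHoms
import HarnessLib

/-!
# The inner correction `δ_v` of a conjugation datum fixes the `p`-power roots of unity at a
# Kolyvagin prime, for EVERY `ConjugationDatum` (proofs file; the pairing letter `hδ`, datum level)

Topic `NumberTheory/GaloisCohomology/Howard2004` (sequel to `ConjugationDatumInertiaProofs`).
THEOREMS ONLY: no definition, no named fact, no instance, no notation, no `sorry`.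

B. Howard, *The Heegner point Kolyvagin system*, Compositio Math. **140** (2004) = arXiv:1202.6340, §1.3
H.4 (p. 7 L69–82): the pairing `T × Tw(T) → R(1)` is `G_K`-invariant and SYMMETRIC — the tree's
`DualityDatum.equivariant` `e(ρ(g)s, ρ(τ⁻¹gτ)t) = χ(g)·e(s,t)` for the datum's complex conjugation `τ`.
Every local use of H.4 at a degree-two prime `λ = λ̄` (Lemma 1.5.3, Prop. 1.5.9) transports classes along
the datum `(φ_λ, δ_λ)`, and needs the twisted symmetry `e(u, ρ(δ_λ)w) = e(w, ρ(δ_λ)u)` — the LETTER `hδ` of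
`InertLocalPairingSymmetricProofs` / `InertLagrangianTransferProofs` / `InertStubLocalizationTransferProofs` /
`FrobeniusReadoutLagrangianTransferProofs` and of `DVRSetting.engine_h159` (x9-p1-w4 g17, asked at the engine
primes).  By H.4 it reduces to (a) `ρ(τ⁻¹δ_λτ · δ_λ) = 1` and (b) `χ(δ_λ) = 1` in the level ring.  With
`σ̃_λ := τ ∘ δ_λ` (`ConjugationDatumInertiaProofs`: a lift of `σ` FIXING the prime `𝔓_λ` of `\bar ℤ_K`,
[NSW] 12.1.3) and `τ` involutive: `τ⁻¹δ_λτ · δ_λ = σ̃_λ²` lies in `D_{𝔓_λ} = res Γ_{K_λ}` (§1), which settles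
(a) wherever `Γ_{K_λ}` acts trivially; and (b) is the ROOT-OF-UNITY computation of this file (§2):
for `μ ∈ K̄` with `μ^{p^c} = 1`, `p^c ∣ ℓ + 1`, `p ∤ ℓ − 1` (`ℓ` the residue characteristic of the degree-two
prime `λ`, `|𝓞_K/λ| = ℓ²`): `μ ≡ a (mod 𝔓_λ)` for some `a ∈ 𝓞_K` (the residue field of `λ` is the set of
solutions of `x^{ℓ²} = x` in `\bar ℤ_K/𝔓_λ`, by counting), so `η := σ̃_λ(μ)·μ ≡ σ(a)·a = N_{K/ℚ}(a) ∈ ℤ`,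
hence `η^ℓ ≡ η`, hence `η^ℓ = η` (roots of unity of order prime to `𝔓_λ` are distinct modulo `𝔓_λ`, the
tree's `eq_of_pow_eq_one_of_sub_mem`), so `η ∈ μ_{p^c} ∩ μ_{ℓ−1} = 1`: **`σ̃_λ μ = μ⁻¹`**; and `τ` inverts the
roots of unity (the tree's Artin–Schreier consequence `apply_eq_inv_of_isLiftOfAut_of_pow_eq_one`), so
**`δ_λ • μ = μ`** and **`χ(δ_λ) ≡ 1 (mod p^c)`** (§3, `PadicInt.toZModPow`).

* §1 `ConjugationDatum.τ_symm_apply` (`τ⁻¹ = τ`), `conjLift_apply` (`σ̃_v x = τ (δ_v • x)`),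
  **`conj_delta_mul_delta_smul`** (`(τ⁻¹δ_vτ · δ_v) • x = σ̃_v (σ̃_v x)`),
  **`conj_delta_mul_delta_mem_range_absGaloisRestrict`** (`σ • v = v ⇒ τ⁻¹δ_vτ · δ_v ∈ res Γ_{K_v}`).
* §2 **`conjLift_apply_mul_self_eq_one_of_pow_eq_one`** (`σ̃_v μ · μ = 1`) and
  **`delta_smul_eq_self_of_pow_eq_one`** (`δ_v • μ = μ`) for `μ^{p^c} = 1` at a degree-two prime `v = σv`
  over `ℓ` with `p^c ∣ ℓ + 1`, `p ∤ ℓ − 1`, `p ≠ ℓ`.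
* §3 **`toZModPow_cyclotomicCharacter_delta_eq_one`** (`χ(δ_v) ≡ 1 (mod p^c)`, `1 ≤ c`) and
  **`algebraMap_cyclotomicCharacter_delta_eq_one`** (`χ(δ_v) = 1` in every `ℤ_p`-algebra killed by `p^c`).

Cell `pub/bsd-print-x9`, G87 = Howard 2004 Thm. 1.6.1 (print leaf `stub_h161` of stmt-BirchSwinnertonDyer-22642);
seat `bsd-line-x10b-p1-w5` g9, brick (DATUM-GEN) part 3 = (hδ-CHI).  NOT HERE: the H.4 algebra `hχ ⇒ hδ` on a
`DVRSetting` (x9-p1-w4 g17, hδ-ALG) and the S-level `datum_hχ` (next file); `thm161_dvrKolyvaginBound` is NOT proved;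
no summit statement is proved; BSD is not proved by any of this.

References: [Howard2004HeegnerKolyvagin] H.4 (arXiv p. 7 L69–82), Def. 1.2.1 (p. 6 L57–68), Lemma 1.5.3 (p. 10);
[GrossLMS1991] §3 (3.3) (`Frob(ℓ)` and complex conjugation on `μ_p`); [SerreLocalFields1979] Ch. II §4 Prop. 8;
[NeukirchSchmidtWingberg2008] Cor. 12.1.3.
-/

set_option autoImplicit false

noncomputable section

open scoped Pointwise NumberField
open NumberField IsDedekindDomain Field Polynomial

namespace Literature.NumberTheory.GaloisCohomology.Howard2004

open Literature.NumberTheory.GaloisRepresentations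
open Literature.NumberTheory.NumberFields
open Literature.NumberTheory.EllipticCurves

variable {K : Type} [Field K] [NumberField K]

namespace ConjugationDatum

/-! ## §1 `τ⁻¹ = τ`, `σ̃_v = τ ∘ δ_v`, and `τ⁻¹δ_vτ · δ_v = σ̃_v²` -/

/-- `τ⁻¹ = τ`: the datum's complex conjugation is an involution. [cite: Howard2004HeegnerKolyvagin, §1.3 (arXiv p. 5 L8, p. 7 L33–41: τ a complex conjugation)] -/
theorem τ_symm_apply (cd : ConjugationDatum K) (x : AlgebraicClosure K) : cd.τ.symm x = cd.τ x := by
  rw [RingEquiv.symm_apply_eq, cd.involutive x]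

/-- Unfolding `σ̃_v := τ ∘ δ_v`: `σ̃_v x = τ (δ_v • x)`. [cite: Howard2004HeegnerKolyvagin, §1.3 (arXiv p. 7 L44–48)] -/
theorem conjLift_apply (cd : ConjugationDatum K) (v : HeightOneSpectrum (𝓞 K)) (x : AlgebraicClosure K) :
    ((absoluteGaloisGroup.toAlgEquiv K (cd.δ v)).toRingEquiv.trans cd.τ) x = cd.τ (cd.δ v • x) := rfl

/-- **`(τ⁻¹δ_vτ · δ_v) • x = σ̃_v (σ̃_v x)`**: the square of the lift `σ̃_v = τ ∘ δ_v` is the element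
`cd.conj (δ_v) * δ_v` of `Γ_K` (`τ` involutive). [cite: Howard2004HeegnerKolyvagin, §1.3 (arXiv p. 7 L33–48)] -/
theorem conj_delta_mul_delta_smul (cd : ConjugationDatum K) (v : HeightOneSpectrum (𝓞 K)) (x : AlgebraicClosure K) :
    (cd.conj (cd.δ v) * cd.δ v) • x =
      ((absoluteGaloisGroup.toAlgEquiv K (cd.δ v)).toRingEquiv.trans cd.τ)
        (((absoluteGaloisGroup.toAlgEquiv K (cd.δ v)).toRingEquiv.trans cd.τ) x) := by
  rw [mul_smul, conjLift_apply, conjLift_apply, absoluteGaloisGroup.smul_def (cd.conj (cd.δ v))]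
  change cd.τ.symm ((absoluteGaloisGroup.toAlgEquiv K (cd.δ v)) (cd.τ (cd.δ v • x))) = _
  rw [τ_symm_apply]
  rfl

-- the pointwise `MulAction` of `Γ_K` on the ideals of `\bar ℤ_K` is slow to synthesise
set_option synthInstance.maxHeartbeats 160000 in
/-- **`τ⁻¹δ_vτ · δ_v ∈ res Γ_{K_v}` at a place with `σ • v = v`**: `σ̃_v` fixes the prime `𝔓_v` of `\bar ℤ_K`
(`mem_adicCompletionPrime_iff_of_smul_eq`, [NSW] 12.1.3), hence so does `σ̃_v² = τ⁻¹δ_vτ · δ_v ∈ Γ_K`, i.e.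
it lies in `D_{𝔓_v} = res Γ_{K_v}` (Neukirch II (9.6)). Consequence: it acts on `T` through `Γ_{K_v}` — trivially
wherever `Γ_{K_v}` does. [cite: Howard2004HeegnerKolyvagin, §1.3 (arXiv p. 7 L44–48)] [cite: NeukirchSchmidtWingberg2008, Cor. 12.1.3] -/
theorem conj_delta_mul_delta_mem_range_absGaloisRestrict (cd : ConjugationDatum K)
    {v : HeightOneSpectrum (𝓞 K)} (h : cd.σ • v = v) :
    cd.conj (cd.δ v) * cd.δ v ∈ (absGaloisRestrict K (v.adicCompletion K)).toMonoidHom.range := by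
  rw [← decompositionSubgroup_adicCompletionPrime_eq_range, Ideal.mem_decompositionSubgroup_iff]
  have hfix := cd.mem_adicCompletionPrime_iff_of_smul_eq h
  -- `(σ̃²) • x ∈ 𝔓_v ↔ x ∈ 𝔓_v` for algebraic integers `x`
  have key : ∀ x : absIntegers (𝓞 K) K,
      (cd.conj (cd.δ v) * cd.δ v) • x ∈ adicCompletionPrime K v ↔ x ∈ adicCompletionPrime K v := by
    intro x
    set y : absIntegers (𝓞 K) K :=
      ⟨((absoluteGaloisGroup.toAlgEquiv K (cd.δ v)).toRingEquiv.trans cd.τ) x,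
        ringEquiv_apply_mem_absIntegers _ x.2⟩ with hy
    have h1 : x ∈ adicCompletionPrime K v ↔ y ∈ adicCompletionPrime K v := hfix x
    have h2 : y ∈ adicCompletionPrime K v ↔
        (⟨((absoluteGaloisGroup.toAlgEquiv K (cd.δ v)).toRingEquiv.trans cd.τ) y,
          ringEquiv_apply_mem_absIntegers _ y.2⟩ : absIntegers (𝓞 K) K) ∈ adicCompletionPrime K v := hfix y
    have h3 : (cd.conj (cd.δ v) * cd.δ v) • x =
        ⟨((absoluteGaloisGroup.toAlgEquiv K (cd.δ v)).toRingEquiv.trans cd.τ) y,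
          ringEquiv_apply_mem_absIntegers _ y.2⟩ := by
      apply Subtype.ext
      rw [integralClosure.coe_smul, conj_delta_mul_delta_smul]
    rw [h3, ← h2, ← h1]
  ext x
  rw [Ideal.mem_pointwise_smul_iff_inv_smul_mem]
  constructor
  · intro hx
    have := (key ((cd.conj (cd.δ v) * cd.δ v)⁻¹ • x)).mpr hx
    rwa [smul_inv_smul] at this
  · intro hx
    apply (key _).mp
    rwa [smul_inv_smul]

/-! ## §2 `σ̃_v μ = μ⁻¹` and `δ_v • μ = μ` for the `p`-power roots of unity at a Kolyvagin prime -/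

omit [NumberField K] in
/-- A root of unity lies in `\bar ℤ_K`. [folklore] -/
private theorem mem_absIntegers_of_pow_eq_one {μ : AlgebraicClosure K} {n : ℕ} (hn : n ≠ 0) (hμ : μ ^ n = 1) :
    μ ∈ absIntegers (𝓞 K) K := by
  have h1 : IsIntegral ℤ μ := by
    refine ⟨X ^ n - 1, monic_X_pow_sub_C (1 : ℤ) hn, ?_⟩
    simp [hμ]
  exact mem_integralClosure_iff _ _ |>.mpr h1.tower_top

/-- In an imaginary quadratic field: `a · σ(a) ∈ ℤ` for `a ∈ 𝓞_K` (the norm; `Aut(K/ℚ) = {1, σ}`). [folklore] -/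
private theorem exists_int_mul_sigma_eq (hK : IsImaginaryQuadratic K) (σ : K ≃ₐ[ℚ] K) (hσ : σ ≠ 1) (a : 𝓞 K) :
    ∃ n : ℤ, (a : K) * σ (a : K) = (n : K) := by
  classical
  haveI : Algebra.IsQuadraticExtension ℚ K := ⟨hK.1⟩
  have hcard : Fintype.card (K ≃ₐ[ℚ] K) = 2 := by
    rw [Fintype.card_eq_nat_card, IsGalois.card_aut_eq_finrank, hK.1]
  have huniv : (Finset.univ : Finset (K ≃ₐ[ℚ] K)) = {1, σ} := by
    symm
    apply Finset.eq_of_subset_of_card_le (Finset.subset_univ _)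
    rw [Finset.card_univ, hcard, Finset.card_pair (Ne.symm hσ)]
  have h := Algebra.norm_eq_prod_automorphisms ℚ (a : K)
  rw [huniv, Finset.prod_pair (Ne.symm hσ), AlgEquiv.one_apply] at h
  refine ⟨Algebra.norm ℤ a, ?_⟩
  rw [← h, ← Algebra.coe_norm_int a]
  simp

/-- **`σ̃_v μ · μ = 1` for a `p^c`-th root of unity `μ` at a degree-two prime** (`K` imaginary quadratic, `v = σv` over
the rational prime `ℓ` with `|𝓞_K/v| = ℓ²`, `p ≠ ℓ`, `p^c ∣ ℓ + 1`, `p ∤ ℓ − 1`).  Proof: `μ ≡ a (mod 𝔓_v)` for some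
`a ∈ 𝓞_K` — the residue field of `v` is the full set of solutions of `x^{ℓ²} = x` in `\bar ℤ_K/𝔓_v` (counting), and
`μ^{ℓ²} = μ`; `σ̃_v` fixes `𝔓_v` and restricts to `σ` on `K`, so `η := σ̃_v(μ)·μ ≡ σ(a)·a = N(a) ∈ ℤ`, whence
`η^ℓ ≡ η (mod 𝔓_v)` (Fermat), `η^ℓ = η` (distinctness of the `p^c`-th roots of unity modulo `𝔓_v ∌ p`), and
`η ∈ μ_{p^c} ∩ μ_{ℓ−1} = {1}`.  (Gross 1991 (3.3): at a Kolyvagin prime, `Frob(ℓ)` acts on `μ_p` by inversion.)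
[cite: GrossLMS1991, §3 (3.3)] [cite: Howard2004HeegnerKolyvagin, Def. 1.2.1 and H.4 (arXiv p. 6 L57–68, p. 7 L69–82)] [cite: SerreLocalFields1979, Ch. II §4 Prop. 8] -/
theorem conjLift_apply_mul_self_eq_one_of_pow_eq_one (cd : ConjugationDatum K) (hK : IsImaginaryQuadratic K)
    {v : HeightOneSpectrum (𝓞 K)} (h : cd.σ • v = v) {ℓ : ℕ} (hℓ : ℓ.Prime) (hℓv : (ℓ : 𝓞 K) ∈ v.asIdeal)
    (hdeg : Nat.card (𝓞 K ⧸ v.asIdeal) = ℓ ^ 2) {p : ℕ} [Fact p.Prime] (hpv : (p : 𝓞 K) ∉ v.asIdeal) {c : ℕ}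
    (hc : p ^ c ∣ ℓ + 1) (hpl : ¬ p ∣ ℓ - 1) {μ : AlgebraicClosure K} (hμ : μ ^ p ^ c = 1) :
    ((absoluteGaloisGroup.toAlgEquiv K (cd.δ v)).toRingEquiv.trans cd.τ) μ * μ = 1 := by
  classical
  have hp : p.Prime := Fact.out
  have hpc0 : p ^ c ≠ 0 := pow_ne_zero _ hp.ne_zero
  set σt := (absoluteGaloisGroup.toAlgEquiv K (cd.δ v)).toRingEquiv.trans cd.τ with hσt
  set 𝔓 := adicCompletionPrime K v with h𝔓def
  haveI : 𝔓.IsMaximal := adicCompletionPrime_isMaximal K v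
  have hunder : 𝔓.under (𝓞 K) = v.asIdeal := under_adicCompletionPrime K v
  -- integrality
  have hμint : μ ∈ absIntegers (𝓞 K) K := mem_absIntegers_of_pow_eq_one hpc0 hμ
  set μ' : absIntegers (𝓞 K) K := ⟨μ, hμint⟩ with hμ'def
  have hμ'pow : μ' ^ p ^ c = 1 := Subtype.ext (by simp [hμ'def, hμ])
  -- `μ^{ℓ²} = μ`
  have hℓ21 : p ^ c ∣ ℓ ^ 2 - 1 := by
    have : ℓ ^ 2 - 1 = (ℓ + 1) * (ℓ - 1) := by simpa using Nat.sq_sub_sq ℓ 1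
    rw [this]
    exact Dvd.dvd.mul_right hc _
  have hμsq : μ' ^ ℓ ^ 2 = μ' := by
    obtain ⟨d, hd⟩ := hℓ21
    have h1 : ℓ ^ 2 = (ℓ ^ 2 - 1) + 1 := (Nat.sub_add_cancel (Nat.one_le_pow _ _ hℓ.pos)).symm
    rw [h1, pow_succ, hd, pow_mul, hμ'pow, one_pow, one_mul]
  -- ### the residue map `𝓞_K/v → \bar ℤ_K/𝔓_v` and the counting step: `μ ≡ a (mod 𝔓_v)`
  haveI : v.asIdeal.IsMaximal := v.isMaximal
  letI : Field (𝓞 K ⧸ v.asIdeal) := Ideal.Quotient.field _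
  letI : Field (absIntegers (𝓞 K) K ⧸ 𝔓) := Ideal.Quotient.field _
  haveI : Finite (𝓞 K ⧸ v.asIdeal) := v.asIdeal.finiteQuotientOfFreeOfNeBot v.ne_bot
  letI : Fintype (𝓞 K ⧸ v.asIdeal) := Fintype.ofFinite _
  have hle : v.asIdeal ≤ 𝔓.comap (algebraMap (𝓞 K) (absIntegers (𝓞 K) K)) := by
    rw [← Ideal.under_def, hunder]
  set f : 𝓞 K ⧸ v.asIdeal →+* absIntegers (𝓞 K) K ⧸ 𝔓 :=
    Ideal.quotientMap 𝔓 (algebraMap (𝓞 K) (absIntegers (𝓞 K) K)) hle with hf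
  have hcardk : Fintype.card (𝓞 K ⧸ v.asIdeal) = ℓ ^ 2 := by rw [← Nat.card_eq_fintype_card, hdeg]
  have hq1 : 1 < ℓ ^ 2 := Nat.one_lt_pow two_ne_zero hℓ.one_lt
  set T : Finset (absIntegers (𝓞 K) K ⧸ 𝔓) := Finset.univ.image f with hT
  have hTcard : T.card = ℓ ^ 2 := by
    rw [hT, Finset.card_image_of_injective _ f.injective, Finset.card_univ, hcardk]
  have hne : (X ^ ℓ ^ 2 - X : (absIntegers (𝓞 K) K ⧸ 𝔓)[X]) ≠ 0 := FiniteField.X_pow_card_sub_X_ne_zero _ hq1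
  set Rt : Finset (absIntegers (𝓞 K) K ⧸ 𝔓) := (X ^ ℓ ^ 2 - X : (absIntegers (𝓞 K) K ⧸ 𝔓)[X]).roots.toFinset
    with hRt
  have hmemRt : ∀ t, t ∈ Rt ↔ t ^ ℓ ^ 2 = t := by
    intro t
    rw [hRt, Multiset.mem_toFinset, mem_roots hne, IsRoot.def, eval_sub, eval_pow, eval_X, sub_eq_zero]
  have hRtcard : Rt.card ≤ ℓ ^ 2 := by
    calc Rt.card ≤ Multiset.card (X ^ ℓ ^ 2 - X : (absIntegers (𝓞 K) K ⧸ 𝔓)[X]).roots :=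
          Multiset.toFinset_card_le _
      _ ≤ (X ^ ℓ ^ 2 - X : (absIntegers (𝓞 K) K ⧸ 𝔓)[X]).natDegree := card_roots' _
      _ = ℓ ^ 2 := FiniteField.X_pow_card_sub_X_natDegree_eq _ hq1
  have hTsub : T ⊆ Rt := by
    intro t ht
    rw [hT, Finset.mem_image] at ht
    obtain ⟨x, -, rfl⟩ := ht
    rw [hmemRt, ← map_pow, ← hcardk, FiniteField.pow_card]
  have hTeq : T = Rt := Finset.eq_of_subset_of_card_le hTsub (by rw [hTcard]; exact hRtcard)
  have hμbar : Ideal.Quotient.mk 𝔓 μ' ∈ T := by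
    rw [hTeq, hmemRt, ← map_pow, hμsq]
  rw [hT, Finset.mem_image] at hμbar
  obtain ⟨x, -, hx⟩ := hμbar
  obtain ⟨a, rfl⟩ := Ideal.Quotient.mk_surjective x
  rw [hf, Ideal.quotientMap_mk, Ideal.Quotient.eq] at hx
  -- `hx : algebraMap a - μ' ∈ 𝔓`
  set α : absIntegers (𝓞 K) K := algebraMap (𝓞 K) (absIntegers (𝓞 K) K) a with hα
  have hαcoe : (α : AlgebraicClosure K) = algebraMap K (AlgebraicClosure K) (a : K) := rfl
  -- ### `σ̃` on `α` and on `μ`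
  have hfix := cd.mem_adicCompletionPrime_iff_of_smul_eq h
  set ασ : absIntegers (𝓞 K) K := ⟨σt α, ringEquiv_apply_mem_absIntegers _ α.2⟩ with hασ
  set μσ : absIntegers (𝓞 K) K := ⟨σt μ', ringEquiv_apply_mem_absIntegers _ μ'.2⟩ with hμσ
  have hασcoe : (ασ : AlgebraicClosure K) = algebraMap K (AlgebraicClosure K) (cd.σ (a : K)) := by
    change σt (algebraMap K (AlgebraicClosure K) (a : K)) = _
    exact cd.conjLift_algebraMap v (a : K)
  -- `σ̃ μ - σ̃ α ∈ 𝔓`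
  have h1 : ασ - μσ ∈ 𝔓 := by
    have h0 := (hfix (α - μ')).mp hx
    have heq : (⟨σt ((α - μ' : absIntegers (𝓞 K) K) : AlgebraicClosure K),
        ringEquiv_apply_mem_absIntegers _ (α - μ').2⟩ : absIntegers (𝓞 K) K) = ασ - μσ := by
      apply Subtype.ext
      simp [hασ, hμσ, map_sub]
    rwa [heq] at h0
  -- `η := σ̃μ · μ ≡ σ̃α · α (mod 𝔓)`
  have h2 : μσ * μ' - ασ * α ∈ 𝔓 := by
    have : μσ * μ' - ασ * α = μσ * (μ' - α) + (μσ - ασ) * α := by ring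
    rw [this]
    refine 𝔓.add_mem (Ideal.mul_mem_left _ _ ?_) (Ideal.mul_mem_right _ _ ?_)
    · have := 𝔓.neg_mem hx
      rwa [neg_sub] at this
    · have := 𝔓.neg_mem h1
      rwa [neg_sub] at this
  -- `σ̃α · α = n ∈ ℤ`
  obtain ⟨n, hn⟩ := exists_int_mul_sigma_eq hK cd.σ cd.σ_ne_one a
  have h3 : ασ * α = (n : absIntegers (𝓞 K) K) := by
    apply Subtype.ext
    rw [Subalgebra.coe_mul, hασcoe, hαcoe, ← map_mul, mul_comm, hn]
    simp
  -- `ℓ ∈ 𝔓` and `p^c ∉ 𝔓`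
  have hℓ𝔓 : ((ℓ : ℕ) : absIntegers (𝓞 K) K) ∈ 𝔓 := by
    have : (algebraMap (𝓞 K) (absIntegers (𝓞 K) K)) (ℓ : 𝓞 K) ∈ 𝔓 := by
      rw [← Ideal.mem_comap, ← Ideal.under_def, hunder]; exact hℓv
    simpa using this
  have hpc𝔓 : ((p ^ c : ℕ) : absIntegers (𝓞 K) K) ∉ 𝔓 := by
    intro hmem
    apply hpv
    have h' : (algebraMap (𝓞 K) (absIntegers (𝓞 K) K)) ((p : 𝓞 K) ^ c) ∈ 𝔓 := by simpa using hmem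
    rw [← Ideal.mem_comap, ← Ideal.under_def, hunder] at h'
    exact Ideal.IsPrime.mem_of_pow_mem inferInstance c h'
  -- `η^ℓ ≡ η (mod 𝔓)`: Fermat for `n`, and `η ≡ n`
  set η : absIntegers (𝓞 K) K := μσ * μ' with hη
  have hηn : η - (n : absIntegers (𝓞 K) K) ∈ 𝔓 := by rw [← h3]; exact h2
  have h4 : η ^ ℓ - η ∈ 𝔓 := by
    have hferm : ((n : absIntegers (𝓞 K) K)) ^ ℓ - (n : absIntegers (𝓞 K) K) ∈ 𝔓 := by
      have hd : (ℓ : ℤ) ∣ n ^ ℓ - n := by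
        haveI : Fact ℓ.Prime := ⟨hℓ⟩
        rw [← ZMod.intCast_zmod_eq_zero_iff_dvd]
        push_cast
        rw [ZMod.pow_card, sub_self]
      obtain ⟨d, hd⟩ := hd
      have : ((n : absIntegers (𝓞 K) K)) ^ ℓ - (n : absIntegers (𝓞 K) K) =
          ((ℓ : ℕ) : absIntegers (𝓞 K) K) * (d : absIntegers (𝓞 K) K) := by
        have := congrArg (fun z : ℤ => (z : absIntegers (𝓞 K) K)) hd
        push_cast at this
        rw [this]
      rw [this]
      exact Ideal.mul_mem_right _ _ hℓ𝔓
    have hsplit : η ^ ℓ - η = (η ^ ℓ - (n : absIntegers (𝓞 K) K) ^ ℓ) +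
        (((n : absIntegers (𝓞 K) K)) ^ ℓ - (n : absIntegers (𝓞 K) K)) + ((n : absIntegers (𝓞 K) K) - η) := by
      ring
    rw [hsplit]
    refine 𝔓.add_mem (𝔓.add_mem ?_ hferm) ?_
    · obtain ⟨d, hd⟩ := sub_dvd_pow_sub_pow η (n : absIntegers (𝓞 K) K) ℓ
      rw [hd]
      exact Ideal.mul_mem_right _ _ hηn
    · have := 𝔓.neg_mem hηn
      rwa [neg_sub] at this
  -- `η` and `η^ℓ` are `p^c`-th roots of unity, congruent mod `𝔓 ∌ p^c`: they are equal
  have hη_pow : η ^ p ^ c = 1 := by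
    have hμσpow : μσ ^ p ^ c = 1 := by
      apply Subtype.ext
      simp only [hμσ, SubmonoidClass.coe_pow, OneMemClass.coe_one, ← map_pow]
      have : ((μ' : absIntegers (𝓞 K) K) : AlgebraicClosure K) ^ p ^ c = 1 := by simp [hμ'def, hμ]
      rw [this, map_one]
    rw [hη, mul_pow, hμσpow, hμ'pow, one_mul]
  have hηℓ_pow : (η ^ ℓ) ^ p ^ c = 1 := by rw [← pow_mul, mul_comm, pow_mul, hη_pow, one_pow]
  have h5 : η ^ ℓ = η := eq_of_pow_eq_one_of_sub_mem hpc𝔓 hηℓ_pow hη_pow h4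
  -- hence `η^{ℓ-1} = 1`, and `gcd(p^c, ℓ-1) = 1` forces `η = 1`
  have hη1 : η ^ (ℓ - 1) = 1 := by
    have hℓ1 : ℓ = (ℓ - 1) + 1 := (Nat.sub_add_cancel hℓ.one_lt.le).symm
    have hne0 : η ≠ 0 := by
      intro h0
      rw [h0, zero_pow hpc0] at hη_pow
      exact zero_ne_one hη_pow
    have hmul : η ^ (ℓ - 1) * η = 1 * η := by rw [← pow_succ, ← hℓ1, h5, one_mul]
    exact mul_right_cancel₀ hne0 hmul
  have hcop : Nat.gcd (p ^ c) (ℓ - 1) = 1 :=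
    Nat.Coprime.pow_left c ((Nat.Prime.coprime_iff_not_dvd hp).mpr hpl)
  have hη_one : η = 1 := by
    have hg : η ^ Nat.gcd (p ^ c) (ℓ - 1) = 1 := pow_gcd_eq_one.mpr ⟨hη_pow, hη1⟩
    rwa [hcop, pow_one] at hg
  -- read in `K̄`
  have hcoe := congrArg (fun z : absIntegers (𝓞 K) K => (z : AlgebraicClosure K)) hη_one
  simpa [hη, hμσ, hμ'def] using hcoe

/-- **`δ_v • μ = μ` for every `p^c`-th root of unity `μ`** (same hypotheses): `σ̃_v μ = τ (δ_v • μ) = μ⁻¹` (previous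
theorem) and `τ` inverts the roots of unity (`apply_eq_inv_of_isLiftOfAut_of_pow_eq_one`: an involutive lift of the
non-trivial automorphism of a number field is a complex conjugation, Artin–Schreier), `τ² = 1`.
[cite: Howard2004HeegnerKolyvagin, H.4 and §1.3 (arXiv p. 7 L44–82)] [cite: GrossLMS1991, §3 (3.3)] -/
theorem delta_smul_eq_self_of_pow_eq_one (cd : ConjugationDatum K) (hK : IsImaginaryQuadratic K)
    {v : HeightOneSpectrum (𝓞 K)} (h : cd.σ • v = v) {ℓ : ℕ} (hℓ : ℓ.Prime) (hℓv : (ℓ : 𝓞 K) ∈ v.asIdeal)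
    (hdeg : Nat.card (𝓞 K ⧸ v.asIdeal) = ℓ ^ 2) {p : ℕ} [Fact p.Prime] (hpv : (p : 𝓞 K) ∉ v.asIdeal) {c : ℕ}
    (hc : p ^ c ∣ ℓ + 1) (hpl : ¬ p ∣ ℓ - 1) {μ : AlgebraicClosure K} (hμ : μ ^ p ^ c = 1) :
    cd.δ v • μ = μ := by
  have hp : p.Prime := Fact.out
  have hpc0 : p ^ c ≠ 0 := pow_ne_zero _ hp.ne_zero
  have h1 := cd.conjLift_apply_mul_self_eq_one_of_pow_eq_one hK h hℓ hℓv hdeg hpv hc hpl hμ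
  rw [conjLift_apply] at h1
  have h2 : cd.τ (cd.δ v • μ) = μ⁻¹ := eq_inv_of_mul_eq_one_left h1
  have h3 : cd.τ μ = μ⁻¹ :=
    apply_eq_inv_of_isLiftOfAut_of_pow_eq_one cd.σ_ne_one cd.isLift cd.involutive hpc0 hμ
  calc cd.δ v • μ = cd.τ (cd.τ (cd.δ v • μ)) := (cd.involutive _).symm
    _ = cd.τ μ⁻¹ := by rw [h2]
    _ = (cd.τ μ)⁻¹ := map_inv₀ _ _
    _ = μ := by rw [h3, inv_inv]

/-! ## §3 `χ(δ_v) ≡ 1 (mod p^c)` -/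

/-- **`χ(δ_v) ≡ 1 (mod p^c)`** (same hypotheses, `1 ≤ c`): `δ_v` fixes a primitive `p^c`-th root of unity of `K̄`
(§2), on which it acts through `χ(δ_v) mod p^c` (`GaloisRep.cyclotomicCharacter_spec`).
[cite: Howard2004HeegnerKolyvagin, H.4 (arXiv p. 7 L69–82)] [cite: GrossLMS1991, §3 (3.3)] -/
theorem toZModPow_cyclotomicCharacter_delta_eq_one (cd : ConjugationDatum K) (hK : IsImaginaryQuadratic K)
    {v : HeightOneSpectrum (𝓞 K)} (h : cd.σ • v = v) {ℓ : ℕ} (hℓ : ℓ.Prime) (hℓv : (ℓ : 𝓞 K) ∈ v.asIdeal)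
    (hdeg : Nat.card (𝓞 K ⧸ v.asIdeal) = ℓ ^ 2) {p : ℕ} [Fact p.Prime] (hpv : (p : 𝓞 K) ∉ v.asIdeal) {c : ℕ}
    (hc1 : 1 ≤ c) (hc : p ^ c ∣ ℓ + 1) (hpl : ¬ p ∣ ℓ - 1) :
    (((GaloisRep.cyclotomicCharacter K p (cd.δ v) : ℤ_[p]ˣ) : ℤ_[p])).toZModPow c = 1 := by
  have hp : p.Prime := Fact.out
  have hpc0 : p ^ c ≠ 0 := pow_ne_zero _ hp.ne_zero
  have h1c : 1 < p ^ c := Nat.one_lt_pow (by omega) hp.one_lt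
  haveI : NeZero (p ^ c) := ⟨hpc0⟩
  haveI : Fact (1 < p ^ c) := ⟨h1c⟩
  haveI : NeZero ((p ^ c : ℕ) : K) := ⟨by exact_mod_cast hpc0⟩
  haveI : NeZero (p : K) := ⟨by exact_mod_cast hp.ne_zero⟩
  obtain ⟨ζ, hζ⟩ := HasEnoughRootsOfUnity.prim (M := AlgebraicClosure K) (n := p ^ c)
  have hζ1 : ζ ^ p ^ c = 1 := hζ.pow_eq_one
  have hspec := GaloisRep.cyclotomicCharacter_spec K p (cd.δ v) ζ hζ1
  rw [cd.delta_smul_eq_self_of_pow_eq_one hK h hℓ hℓv hdeg hpv hc hpl hζ1] at hspec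
  have ha : ((((GaloisRep.cyclotomicCharacter K p (cd.δ v) : ℤ_[p]ˣ) : ℤ_[p])).toZModPow c).val = 1 := by
    apply hζ.pow_inj (ZMod.val_lt _) h1c
    rw [pow_one]
    exact hspec.symm
  apply ZMod.val_injective (p ^ c)
  rw [ha, ZMod.val_one]

/-- **`χ(δ_v) = 1` in every `ℤ_p`-algebra `A` killed by `p^c`** (same hypotheses): the form consumed by the H.4
algebra on a level ring `R_k` with `char R_k = p^c`. [cite: Howard2004HeegnerKolyvagin, H.4 (arXiv p. 7 L69–82)] -/
theorem algebraMap_cyclotomicCharacter_delta_eq_one (cd : ConjugationDatum K) (hK : IsImaginaryQuadratic K)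
    {v : HeightOneSpectrum (𝓞 K)} (h : cd.σ • v = v) {ℓ : ℕ} (hℓ : ℓ.Prime) (hℓv : (ℓ : 𝓞 K) ∈ v.asIdeal)
    (hdeg : Nat.card (𝓞 K ⧸ v.asIdeal) = ℓ ^ 2) {p : ℕ} [Fact p.Prime] (hpv : (p : 𝓞 K) ∉ v.asIdeal) {c : ℕ}
    (hc1 : 1 ≤ c) (hc : p ^ c ∣ ℓ + 1) (hpl : ¬ p ∣ ℓ - 1)
    {A : Type*} [CommRing A] [Algebra ℤ_[p] A] (hA : ((p ^ c : ℕ) : A) = 0) :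
    algebraMap ℤ_[p] A ((GaloisRep.cyclotomicCharacter K p (cd.δ v) : ℤ_[p]ˣ) : ℤ_[p]) = 1 := by
  have h1 := cd.toZModPow_cyclotomicCharacter_delta_eq_one hK h hℓ hℓv hdeg hpv hc1 hc hpl
  have hker : ((GaloisRep.cyclotomicCharacter K p (cd.δ v) : ℤ_[p]ˣ) : ℤ_[p]) - 1 ∈
      RingHom.ker (PadicInt.toZModPow c : ℤ_[p] →+* ZMod (p ^ c)) := by
    rw [RingHom.mem_ker, map_sub, map_one, h1, sub_self]
  rw [PadicInt.ker_toZModPow, Ideal.mem_span_singleton] at hker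
  obtain ⟨z, hz⟩ := hker
  have heq : ((GaloisRep.cyclotomicCharacter K p (cd.δ v) : ℤ_[p]ˣ) : ℤ_[p]) = 1 + (p : ℤ_[p]) ^ c * z := by
    rw [← hz]; ring
  rw [heq, map_add, map_one, map_mul, map_pow, map_natCast, ← Nat.cast_pow, hA, zero_mul, add_zero]

end ConjugationDatum

end Literature.NumberTheory.GaloisCohomology.Howard2004

end
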